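import Summits.BirchSwinnertonDyer.BirchSwinnertonDyer.Theorems.ThetaPartnerAtTwoSignedMainConjectureCMTwoRankZeroFlatTwistSquarefree
import Summits.BirchSwinnertonDyer.BirchSwinnertonDyer.Theorems.ThetaPartnerAtTwoSignedMainConjectureCMTwoRankZeroFlatTwistImaginarySquarefree
import Literature.NumberTheory.EllipticCurves.QuadraticTwistJInvariantProofs
import Literature.NumberTheory.EllipticCurves.BarriosEtAl2025.QuadraticTwistAtTwoConductorProofs
import Literature.NumberTheory.EllipticCurves.LeadingTermBSZOrdinaryProofs
import Literature.NumberTheory.EllipticCurves.RootNumberProofs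
import Literature.NumberTheory.EllipticCurves.RootNumberSmulProofs
import Literature.NumberTheory.EllipticCurves.PAdicLFunctionNeZeroProofs
import Literature.NumberTheory.EllipticCurves.QuadraticTwistKroneckerRootNumberProofs
import Literature.NumberTheory.EllipticCurves.AtkinLehnerFrickeLevelProofs
import HarnessLib

/-!
# Route `ThetaPartnerAtTwo`, crux K2r0P `SignedMainConjectureCMTwoRankZeroOfPub` (stmt-BirchSwinnertonDyer-24945),
# line `rankzero` v14, stub (μ♭)_A: the FAMILY NODE — (μ♭) on a whole `j`-family (`j ≠ 0, 1728`) of curves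
# good at `2`, from ONE symbol certificate per anchor sign, granted modularity and Abbes–Ullmo

Cell `bsd-wall`, width seat `bsd-wall-tp2-p2-w4` (g7). THEOREMS ONLY (no `def`, no named fact, no `sorry`); helper
`--supports` the crux; sequel of `…FlatTwistSquarefree` (real square-free twists) and `…FlatTwistImaginarySquarefree`
(imaginary square-free twists), namespace `…Theorems.FlatTwist.Family`. Item §4(c) of the crux memo
`Cruxes/SignedMainConjectureCMTwoRankZeroOfPub/FLAT-TWIST-TRANSPORT-w3g2.md` («a per-family FLAT node»).

What is new: every `FlatTwist` transport so far takes the twist datum EXPLICITLY (`d` square-free, `d ≡ 1 (mod 4)`, its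
sign, `(d, N_W) = 1`, `C • W^{(d)} = A`); here it is DERIVED from hypotheses on `A` alone.
* §1 `exists_squarefree_twist_of_j_eq` — `j(A) = j(W) ∉ {0, 1728}` ⟹ `C • W^{(d)} = A` with `d` a SQUARE-FREE INTEGER
  (Silverman X.5.4 over `ℚ`, tree `exists_variableChange_eq_quadraticTwist_of_j_eq`, plus the square-free core of a rational);
* §2 `emod_four_eq_one_of_hasGoodReductionAtPrime_two` — `W` and `A = C • W^{(d)}` BOTH good at `2`, `d` square-free ⟹
  `d ≡ 1 (mod 4)`: otherwise `f₂(W^{(d)}) = 4` or `6` (Barrios et al. 2025, Thm. 5.1, rows `I₀`, tree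
  `BarriosEtAl2025.conductorExponent_quadraticTwist_two_of_le_one_holds`) against `f₂ = 0` at a good place;
* §3 `analyticMuFlat_twist_at_of_certificates` — the two square-free transports (plus certificate for `d > 0`, minus for
  `d < 0`) with `d ≡ 1 (mod 4)` derived, granted `exists_isNewformOf` and Abbes–Ullmo (`hAU` gives `h2` and H⁻(W));
* §4 `rootNumber_twist_eq_of_isSquare`, `analyticMuFlat_twist_at_of_isSquare` — SQUARE conductor `N_W`: the twist has root
  number `sign(d)·w(W)` (tree `rootNumber_quadraticTwist_of_emod_four_eq_one`), so in analytic rank `0` only the sign `w(W)`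
  occurs and ONE certificate at `W` serves;
* §5 `analyticMuFlat_of_j_eq` — THE FAMILY NODE: anchor pair `(W, W′)`, `W′` a model of `W^{(±p)}`, both good supersingular
  at `2` with `a₂ = 0`, `Δ < 0`, `N = p²`, one certificate each ⟹ (μ♭) at EVERY globally minimal `A` with `j(A) = j(W)`, good
  at `2`, `L(A,1) ≠ 0` (twist parameters divisible by `p` are routed through `W′`); `analyticMuFlat_family_of_pub` = the same in
  the binder currency of the registered stub `stub_analyticMuFlatNonUnitCMTwo` restricted to `j(A) = j(W)` (`hmod hLrat hAU`).

Reading: the habitat of FLAT (CM, good supersingular at `2`) is the `j = 0` tail (`y² = x³ + k`, twist families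
indexed by `k` modulo cubes — not covered: `j = 0` is excluded by Silverman X.5.4) plus the five sporadic families with CM by
`ℚ(√−p)`, `p = 11, 19, 43, 67, 163` (minimal conductor `p²`); on each of these §5 reduces the class-wide statement (all
conductors) to TWO numerical symbol certificates. No certificate is computed here; nothing about any particular curve is
asserted; (μ♭) class-wide stays open; BSD is not proved by any of this.

References: Silverman *AEC* (2009) X.5 Prop. 5.4 [SilvermanAEC2009]; Barrios–Roy–Sahajpal–Tallana–Tobin–Wiersema, Res.
Number Theory 11 (2025) Thm. 5.1 [BarriosEtAl2025]; Murty–Murty (1997) Ch. 6 §1 [MurtyMurty1997]; Mazur–Tate–Teitelbaum,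
Invent. Math. 84 (1986) §I.8 [MazurTateTeitelbaum1986Invent]; Pal, Proc. AMS 140 (2012) Thm. 3.2 [Pal2012]; Pollack, Duke
Math. J. 118 (2003) Prop. 6.18 [Pollack2003]; Abbes–Ullmo, Compositio Math. 103 (1996) Thm. A [AbbesUllmo1996].
-/

set_option autoImplicit false
-- the Theorems namespace of this sub repeats the summit name by design (D-0017 nested layout)
set_option linter.dupNamespace false

noncomputable section

open scoped Classical MatrixGroups ModularForm NumberField NumberTheorySymbols

open NumberField IsDedekindDomain Rat.HeightOneSpectrum CongruenceSubgroup
  Literature.NumberTheory.EllipticCurves Literature.NumberTheory.GaloisRepresentations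
  WeierstrassCurve Literature.NumberTheory.EllipticCurves.ModularForms Literature.NumberTheory.EllipticCurves.Rank1Residual
  Literature.NumberTheory.EllipticCurves.Rank1Residual.Typed
  Summit.BirchSwinnertonDyer.Rank1Residual Summit.BirchSwinnertonDyer.Rank1Residual.Supersingular

namespace Summit.BirchSwinnertonDyer.BirchSwinnertonDyer.Theorems.FlatTwist.Family

/-! ## §1. Curves with the same `j ≠ 0, 1728` are SQUARE-FREE INTEGER quadratic twists of each other -/

/-- **Square-free core of a non-zero rational**: `d = m · e²` with `m` a square-free integer and `e ∈ ℚ^×`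
(`d = a/b`, `ab = ± r² m` with `m` square-free, `e = r/b`). [folklore] -/
theorem exists_squarefree_intCast_mul_sq_eq {d : ℚ} (hd : d ≠ 0) :
    ∃ (m : ℤ) (e : ℚ), Squarefree m ∧ e ≠ 0 ∧ (m : ℚ) * e ^ 2 = d := by
  set a : ℤ := d.num with ha
  set b : ℕ := d.den with hb
  have hb0 : (b : ℚ) ≠ 0 := by rw [hb]; exact_mod_cast d.den_nz
  have hbz : (b : ℤ) ≠ 0 := by rw [hb]; exact_mod_cast d.den_nz
  have ha0 : a ≠ 0 := by rw [ha]; exact Rat.num_ne_zero.mpr hd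
  have hd_eq : (a : ℚ) / b = d := by rw [ha, hb]; exact Rat.num_div_den d
  set n : ℤ := a * b with hn_def
  have hn : n ≠ 0 := mul_ne_zero ha0 hbz
  obtain ⟨m₀, r, hrm, hsq⟩ := Nat.sq_mul_squarefree n.natAbs
  -- the sign
  obtain ⟨s, hs, hns⟩ : ∃ s : ℤ, (s = 1 ∨ s = -1) ∧ n = s * (n.natAbs : ℤ) := by
    rcases le_or_gt 0 n with h0 | h0
    · exact ⟨1, Or.inl rfl, by rw [one_mul, Int.natAbs_of_nonneg h0]⟩
    · exact ⟨-1, Or.inr rfl, by rw [Int.ofNat_natAbs_of_nonpos h0.le, neg_one_mul, neg_neg]⟩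
  have key : (a : ℚ) * b = s * (r : ℚ) ^ 2 * m₀ := by
    have h1 : ((n : ℤ) : ℚ) = s * (r : ℚ) ^ 2 * m₀ := by
      rw [hns, ← hrm]; push_cast; ring
    rw [← h1, hn_def]; push_cast; ring
  have hr0 : (r : ℚ) ≠ 0 := by
    intro hr
    have : (a : ℚ) * b = 0 := by rw [key, hr]; ring
    exact mul_ne_zero (by exact_mod_cast ha0) hb0 this
  refine ⟨s * (m₀ : ℤ), (r : ℚ) / b, ?_, div_ne_zero hr0 hb0, ?_⟩
  · -- `|s m₀| = m₀` is square-free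
    rw [← Int.squarefree_natAbs]
    have habs : (s * (m₀ : ℤ)).natAbs = m₀ := by
      rcases hs with rfl | rfl <;> simp
    rw [habs]
    exact hsq
  · rw [← hd_eq, div_pow]
    field_simp
    push_cast
    linear_combination key.symm

/-- **Elliptic curves over `ℚ` with the same `j`-invariant `j ≠ 0, 1728` are square-free integer quadratic twists of each
other**: if `j(A) = j(W)` with `j(W) ≠ 0, 1728` then `C • W^{(d)} = A` for some SQUARE-FREE `d ∈ ℤ` and some admissible
change of variables `C` over `ℚ` (Silverman X.5.4 over `ℚ` — tree `exists_variableChange_eq_quadraticTwist_of_j_eq` —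
followed by `W^{(m e²)} ≅ W^{(m)}`, `exists_variableChange_quadraticTwist_mul_sq`, with `m` the square-free core of the
rational twist parameter). [cite: SilvermanAEC2009, X.5 Prop. 5.4 and Cor. 5.4.1] -/
theorem exists_squarefree_twist_of_j_eq {W A : WeierstrassCurve ℚ} [W.IsElliptic] [A.IsElliptic]
    (hj : A.j = W.j) (h0 : W.j ≠ 0) (h1728 : W.j ≠ 1728) :
    ∃ d : ℤ, Squarefree d ∧ ∃ C : VariableChange ℚ, C • W.quadraticTwist (d : ℚ) = A := by
  obtain ⟨d₀, hd₀, C, hC⟩ := exists_variableChange_eq_quadraticTwist_of_j_eq (W := A) (E := W) hj h0 h1728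
  obtain ⟨m, e, hm, he, hme⟩ := exists_squarefree_intCast_mul_sq_eq hd₀
  obtain ⟨C', hC'⟩ := W.exists_variableChange_quadraticTwist_mul_sq (m : ℚ) e he
  refine ⟨m, hm, C⁻¹ * C', ?_⟩
  rw [mul_smul, hC', hme, ← hC, inv_smul_smul]

/-! ## §2. Both curves good at `2` forces `d ≡ 1 (mod 4)` (Barrios et al. 2025, Thm. 5.1, rows `I₀`) -/

/-- **The twist class is unramified at `2`.** `W/ℚ` elliptic, good at `2`; `d` a SQUARE-FREE integer; `A = C • W^{(d)}` (any
`ℚ`-model of the twist) ALSO good at `2`. Then `d ≡ 1 (mod 4)`: `4 ∤ d`, and for `d ≡ 3 (mod 4)` resp. `d ≡ 2 (mod 4)` the twist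
has conductor exponent `f₂ = 4` (`I₄*`/`II*`) resp. `6` (`I₈*`/`II`) — Barrios et al. 2025, Thm. 5.1, rows `R = I₀`, column
`(f, f^d)`, tree `BarriosEtAl2025.conductorExponent_quadraticTwist_two_of_le_one_holds` — against `f₂ = 0` at a good place
(`conductorExponent_eq_zero_of_hasGoodReductionAt`; good reduction is an isomorphism invariant, `hasGoodReductionAtPrime_smul_iff`).
The hypothesis `hd4 : d % 4 = 1` of every `FlatTwist` transport, now derived. [cite: SilvermanAEC2009, VII.5 Prop. 5.1]
[cite: BarriosEtAl2025, Thm. 5.1, §5 tables v(d) = 0 / v(d) = 1, rows I₀, column (f, f^d) (arXiv:2501.03209 pp. 15–16)] -/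
theorem emod_four_eq_one_of_hasGoodReductionAtPrime_two (W : WeierstrassCurve ℚ) [W.IsElliptic]
    {A : WeierstrassCurve ℚ} [A.IsElliptic] {d : ℤ} (hsq : Squarefree d) {C : VariableChange ℚ}
    (hA : C • W.quadraticTwist (d : ℚ) = A)
    (hW : W.HasGoodReductionAtPrime 2) (hA2 : A.HasGoodReductionAtPrime 2) : d % 4 = 1 := by
  have hd0 : d ≠ 0 := hsq.ne_zero
  have hdq : (d : ℚ) ≠ 0 := by exact_mod_cast hd0
  haveI := W.isElliptic_quadraticTwist hdq
  set v : HeightOneSpectrum ℤ := (primesEquiv (R := ℤ)).symm ⟨2, Nat.prime_two⟩ with hv_def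
  have hv : natGenerator v = 2 := congrArg Subtype.val ((primesEquiv (R := ℤ)).apply_symm_apply ⟨2, Nat.prime_two⟩)
  -- the twist itself is good at `2` (isomorphism invariance)
  have hT : (W.quadraticTwist (d : ℚ)).HasGoodReductionAtPrime 2 := by
    rw [← hA] at hA2
    exact (BSZLemma17.hasGoodReductionAtPrime_smul_iff (W.quadraticTwist (d : ℚ)) C 2).mp hA2
  have hWv : W.HasGoodReductionAt v :=
    (W.hasGoodReductionAtPrime_iff_hasGoodReductionAt_holds ⟨2, Nat.prime_two⟩).mp hW
  have hTv : (W.quadraticTwist (d : ℚ)).HasGoodReductionAt v :=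
    ((W.quadraticTwist (d : ℚ)).hasGoodReductionAtPrime_iff_hasGoodReductionAt_holds ⟨2, Nat.prime_two⟩).mp hT
  have hfW : W.conductorExponent v ≤ 1 := by
    rw [WeierstrassCurve.conductorExponent_eq_zero_of_hasGoodReductionAt v W hWv]; exact Nat.zero_le _
  have hfT : (W.quadraticTwist (d : ℚ)).conductorExponent v = 0 :=
    WeierstrassCurve.conductorExponent_eq_zero_of_hasGoodReductionAt v _ hTv
  obtain ⟨k3, k2⟩ := BarriosEtAl2025.conductorExponent_quadraticTwist_two_of_le_one_holds W v hv hfW d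
  have h4 : ¬ (4 : ℤ) ∣ d := by
    rintro ⟨k, hk⟩
    have hu : IsUnit (2 : ℤ) := hsq 2 ⟨k, by rw [hk]; ring⟩
    rcases Int.isUnit_iff.mp hu with h | h <;> omega
  have hcases : d % 4 = 0 ∨ d % 4 = 1 ∨ d % 4 = 2 ∨ d % 4 = 3 := by omega
  rcases hcases with h | h | h | h
  · exact absurd (Int.dvd_of_emod_eq_zero h) h4
  · exact h
  · exact absurd hfT (by rw [k2 h]; decide)
  · exact absurd hfT (by rw [k3 h]; decide)

/-! ## §3. Transport with the twist class DERIVED: plus certificate for `d > 0`, minus certificate for `d < 0` -/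

section Transport

variable (W : WeierstrassCurve ℚ) [W.IsElliptic] [W.IsGloballyMinimal] {d : ℤ} {A : WeierstrassCurve ℚ}
  [A.IsElliptic] [A.IsGloballyMinimal] [NeZero (W.conductorNorm ℤ)] [NeZero (A.conductorNorm ℤ)]
  {fW : CuspForm (Gamma0 (W.conductorNorm ℤ)) 2} {fA : CuspForm (Gamma0 (A.conductorNorm ℤ)) 2}

/-- **(μ♭) AT A SQUARE-FREE TWIST OF EITHER SIGN, the class `d (mod 4)` derived.** Anchor `W/ℚ` globally minimal, good
supersingular at `2` with `a₂(W) = 0`, `Δ(W) < 0`, newform `f_W`; twist datum: `d` square-free, `(d, N_W) = 1`,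
`C • W^{(d)} = A` with `A` globally minimal, GOOD AT `2`, of newform `f_A` with `L(A,1) ≠ 0`. Certificates at the anchor,
each asked only for the sign that occurs: for `d > 0` the plus certificate «some `[b/4^k]⁺_{f_W} − [0]⁺_{f_W}` (`k ≥ 1`, `b` odd)
is half an odd integer», for `d < 0` the minus certificate «some `2[b/4^k]⁻_{f_W}` is odd». Granted modularity
(`exists_isNewformOf`) and Abbes–Ullmo (`hAU`, supplying the period unit at `2` and the minus unit H⁻(W)): (μ♭) holds at every
Pollack pair of `f_A` (the class `d ≡ 1 (mod 4)` the two square-free transports require is §2). BSD is not proved by this.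
[cite: BarriosEtAl2025, Thm. 5.1, rows I₀] [cite: Pal2012, Thm. 3.2] [cite: AbbesUllmo1996, Thm. A] [cite: Pollack2003, Prop. 6.18] -/
theorem analyticMuFlat_twist_at_of_certificates (hmod : exists_isNewformOf)
    (hAU : abbesUllmo_not_dvd_maninConstant_of_not_dvd_level)
    (hss : GoodSS W 2) (haW : W.frobeniusTrace 2 = 0) (hΔ : W.Δ < 0) (hfW : IsNewformOf W fW)
    (hplus : 0 < d → ∃ k : ℕ, 1 ≤ k ∧ ∃ b : ℤ, Odd b ∧ ∃ m : ℤ, Odd m ∧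
      ratPlusSymbol fW ((b : ℚ) / 4 ^ k) = ratPlusSymbol fW 0 + (m : ℚ) / 2)
    (hminus : d < 0 → ∃ k : ℕ, 1 ≤ k ∧ ∃ b : ℤ, Odd b ∧ ∃ m : ℤ, Odd m ∧
      2 * ratMinusSymbol fW ((b : ℚ) / 4 ^ k) = m)
    (hsq : Squarefree d) (hcop : IsCoprime d (W.conductorNorm ℤ : ℤ)) {C : VariableChange ℚ}
    (hA : C • W.quadraticTwist (d : ℚ) = A) (hgoodA : A.HasGoodReductionAtPrime 2)
    (hfA : IsNewformOf A fA) (hLA : A.entireLFunction 1 ≠ 0)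
    (Lplus Lminus : IwasawaAlgebra 2) (hPP : IsPollackPair fA 2 Lplus Lminus) :
    ∃ n : ℕ, IsUnit (PowerSeries.coeff n (kobayashiL 1 Lplus Lminus)) := by
  have hd4 : d % 4 = 1 := emod_four_eq_one_of_hasGoodReductionAtPrime_two W hsq hA hss.1 hgoodA
  have h2 := SkinnerUrban2014.realPeriodRat_eq_unit_mul_plusPeriod_two_fact_of_abbesUllmo hAU
  rcases lt_or_gt_of_ne hsq.ne_zero with hd | hd
  · obtain ⟨ϖ, hϖ1, hϖ⟩ := FlatTwist.Imaginary.exists_minusUnit_of_abbesUllmo W hAU hss hΔ fW hfW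
    exact FlatTwist.Imaginary.analyticMuFlat_negTwist_at_of_exists_oddMinus_squarefree W hmod h2 hss haW hΔ hd hd4 hsq
      hcop hA hfW hfA hLA hϖ1 hϖ (hminus hd) Lplus Lminus hPP
  · exact FlatTwist.Squarefree.analyticMuFlat_twist_at_of_exists_odd W hmod h2 hss haW hd hd4 hsq hcop hA hfW hfA hLA
      (hplus hd) Lplus Lminus hPP

/-! ## §4. Square conductor: the root number of the twist is `sign(d)·w(W)`, so ONE certificate serves -/

omit [W.IsGloballyMinimal] [A.IsElliptic] [A.IsGloballyMinimal] [NeZero (W.conductorNorm ℤ)]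
  [NeZero (A.conductorNorm ℤ)] in
/-- **Root number of a square-free twist of a curve of SQUARE conductor.** For `W/ℚ` elliptic with `N_W` a perfect square,
`d` square-free, `d ≡ 1 (mod 4)`, `(d, N_W) = 1` and any model `A = C • W^{(d)}`: `w(A) = w(W)` if `d > 0` and
`w(A) = −w(W)` if `d < 0` — from `w(W^{(D)}) = (−1/|D|)(N_W/|D|)·w(W)` (Murty–Murty Ch. 6 §1, tree
`rootNumber_quadraticTwist_of_emod_four_eq_one`, granted modularity) with `(N_W/|D|) = 1` for a square and
`(−1/|D|) = χ₄(|D|) = sign D` for `D ≡ 1 (mod 4)`; `w` is an isomorphism invariant (`rootNumber_smul_holds`).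
[cite: MurtyMurty1997, Ch. 6 §1 (functional equation of L_D(s, f))] -/
theorem rootNumber_twist_eq_of_isSquare (hmod : exists_isNewformOf) (hd4 : d % 4 = 1) (hsq : Squarefree d)
    (hcop : IsCoprime d (W.conductorNorm ℤ : ℤ)) (hN : IsSquare (W.conductorNorm ℤ)) {C : VariableChange ℚ}
    (hA : C • W.quadraticTwist (d : ℚ) = A) :
    (0 < d → A.rootNumber = W.rootNumber) ∧ (d < 0 → A.rootNumber = -W.rootNumber) := by
  have hd0 : d ≠ 0 := hsq.ne_zero
  have hdq : (d : ℚ) ≠ 0 := by exact_mod_cast hd0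
  haveI := W.isElliptic_quadraticTwist hdq
  have hgcd : Int.gcd d (W.conductorNorm ℤ) = 1 := Int.isCoprime_iff_gcd_eq_one.mp hcop
  obtain ⟨hw, -⟩ := W.rootNumber_quadraticTwist_of_emod_four_eq_one hmod hd4 hsq hgcd
  have hAw : A.rootNumber = (W.quadraticTwist (d : ℚ)).rootNumber := by
    rw [← hA]; exact (W.quadraticTwist (d : ℚ)).rootNumber_smul_holds C
  -- `(N_W / |d|) = 1` for a square `N_W` prime to `d`
  obtain ⟨s, hs⟩ := hN
  have hJN : J((W.conductorNorm ℤ : ℤ) | d.natAbs) = 1 := by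
    have hcs : IsCoprime (s : ℤ) d := by
      have h : IsCoprime d ((s : ℤ) * s) := by
        have h' := hcop
        rw [hs] at h'
        push_cast at h'
        exact h'
      exact h.of_mul_right_left.symm
    have hg : (s : ℤ).gcd (d.natAbs : ℤ) = 1 := by
      have h := Int.isCoprime_iff_gcd_eq_one.mp hcs
      rw [Int.gcd_eq_natAbs] at h ⊢
      simpa [Int.natAbs_abs] using h
    rw [hs]; push_cast; rw [← sq]
    exact jacobiSym.sq_one' hg
  have hodd : Odd d.natAbs := Int.natAbs_odd.mpr (Int.odd_iff.mpr (by omega))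
  rw [hAw, hw, hJN, mul_one, jacobiSym.at_neg_one hodd]
  refine ⟨fun hd ↦ ?_, fun hd ↦ ?_⟩
  · rw [ZMod.χ₄_nat_one_mod_four (by omega), one_mul]
  · rw [ZMod.χ₄_nat_three_mod_four (by omega)]; ring

/-- **(μ♭) AT EVERY GOOD-AT-2 SQUARE-FREE TWIST OF A SQUARE-CONDUCTOR ANCHOR, from ONE certificate.** Same anchor `W` as in
`analyticMuFlat_twist_at_of_certificates` with moreover `N_W` a perfect SQUARE (e.g. `N_W = p²`). In analytic rank `0`
(`L(A,1) ≠ 0` forces `w(A) = +1`) the sign of `d` is `w(W)` (§4), so the plus certificate is asked only if `w(W) = +1` and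
the minus certificate only if `w(W) = −1`: ONE certificate at `W` certifies (μ♭) at EVERY globally minimal `A = C • W^{(d)}`
good at `2` with `d` square-free prime to `N_W` and `L(A,1) ≠ 0`. BSD is not proved by this.
[cite: BarriosEtAl2025, Thm. 5.1, rows I₀] [cite: MurtyMurty1997, Ch. 6 §1] [cite: Pal2012, Thm. 3.2] [cite: AbbesUllmo1996, Thm. A]
[cite: Pollack2003, Prop. 6.18] -/
theorem analyticMuFlat_twist_at_of_isSquare (hmod : exists_isNewformOf)
    (hAU : abbesUllmo_not_dvd_maninConstant_of_not_dvd_level)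
    (hss : GoodSS W 2) (haW : W.frobeniusTrace 2 = 0) (hΔ : W.Δ < 0) (hfW : IsNewformOf W fW)
    (hN : IsSquare (W.conductorNorm ℤ))
    (hplus : W.rootNumber = 1 → ∃ k : ℕ, 1 ≤ k ∧ ∃ b : ℤ, Odd b ∧ ∃ m : ℤ, Odd m ∧
      ratPlusSymbol fW ((b : ℚ) / 4 ^ k) = ratPlusSymbol fW 0 + (m : ℚ) / 2)
    (hminus : W.rootNumber = -1 → ∃ k : ℕ, 1 ≤ k ∧ ∃ b : ℤ, Odd b ∧ ∃ m : ℤ, Odd m ∧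
      2 * ratMinusSymbol fW ((b : ℚ) / 4 ^ k) = m)
    (hsq : Squarefree d) (hcop : IsCoprime d (W.conductorNorm ℤ : ℤ)) {C : VariableChange ℚ}
    (hA : C • W.quadraticTwist (d : ℚ) = A) (hgoodA : A.HasGoodReductionAtPrime 2)
    (hfA : IsNewformOf A fA) (hLA : A.entireLFunction 1 ≠ 0)
    (Lplus Lminus : IwasawaAlgebra 2) (hPP : IsPollackPair fA 2 Lplus Lminus) :
    ∃ n : ℕ, IsUnit (PowerSeries.coeff n (kobayashiL 1 Lplus Lminus)) := by
  have hd4 : d % 4 = 1 := emod_four_eq_one_of_hasGoodReductionAtPrime_two W hsq hA hss.1 hgoodA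
  have hwA : A.rootNumber = 1 := WeierstrassCurve.rootNumber_eq_one_of_entireLFunction_one_ne_zero hLA
  obtain ⟨hpos, hneg⟩ := rootNumber_twist_eq_of_isSquare W hmod hd4 hsq hcop hN hA
  refine analyticMuFlat_twist_at_of_certificates W hmod hAU hss haW hΔ hfW (fun hd ↦ hplus ?_) (fun hd ↦ hminus ?_)
    hsq hcop hA hgoodA hfA hLA Lplus Lminus hPP
  · rw [← hpos hd, hwA]
  · have h := hneg hd
    rw [hwA] at h
    omega

end Transport

/-! ## §5. THE FAMILY NODE: (μ♭) on the whole `j`-family from an anchor pair `(W, W′ = W^{(±p)})` -/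

section Family

variable {p : ℕ} (W W' : WeierstrassCurve ℚ) [W.IsElliptic] [W.IsGloballyMinimal] [W'.IsElliptic] [W'.IsGloballyMinimal]
  [NeZero (W.conductorNorm ℤ)] [NeZero (W'.conductorNorm ℤ)]
  {fW : CuspForm (Gamma0 (W.conductorNorm ℤ)) 2} {fW' : CuspForm (Gamma0 (W'.conductorNorm ℤ)) 2}

/-- Coprimality to `N = p²` from `p ∤ d`. [folklore] -/
theorem isCoprime_natCast_of_not_dvd_of_eq_sq (hp : p.Prime) {d : ℤ} (hpd : ¬ (p : ℤ) ∣ d) {N : ℕ}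
    (hN : N = p ^ 2) : IsCoprime d (N : ℤ) := by
  rw [hN]; push_cast
  exact (((Prime.coprime_iff_not_dvd (Nat.prime_iff_prime_int.mp hp)).mpr hpd).symm).pow_right

/-- **THE FAMILY NODE.** Fix a prime `p` and `q = ±p`. ANCHOR PAIR: `W/ℚ` and `W′/ℚ` globally minimal, `W′` a model of the
twist `W^{(q)}` (`C′ • W^{(q)} = W′`), BOTH good supersingular at `2` with `a₂ = 0`, `Δ < 0`, conductor `p²`, newforms
`f_W`, `f_{W′}`, `j(W) ≠ 0, 1728`; at each anchor ONE symbol certificate of the sign of its root number (plus certificate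
«some `[b/4^k]⁺ − [0]⁺` is half an odd integer» if `w = +1`, minus certificate «some `2[b/4^k]⁻` is odd» if `w = −1`).
Grant modularity (`exists_isNewformOf`) and Abbes–Ullmo (`hAU`). THEN for EVERY globally minimal elliptic `A/ℚ` with
`j(A) = j(W)`, good reduction at `2` and `L(A,1) ≠ 0`, every newform `f_A` and every Pollack pair `(L⁺, L⁻)` of `f_A` at `2`:
`∃ n, IsUnit (coeff n (kobayashiL 1 L⁺ L⁻))` — (μ♭) on the WHOLE `j(W)`-family (all conductors). Proof: `A = C • W^{(d)}`
with `d` a square-free integer (§1); if `p ∤ d` then `(d, p²) = 1` and §4 applies at `W`; if `p ∣ d` then `d = q·e` with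
`p ∤ e` (square-free) and `A ≅ W′^{(e)}` (`(W^{(q)})^{(e)} = W^{(qe)}`, `quadraticTwist_quadraticTwist`, `quadraticTwist_smul`),
and §4 applies at `W′`; in both cases `d, e ≡ 1 (mod 4)` is §2. For the five sporadic CM families (`p = 11, 19, 43, 67, 163`,
`q = −p`, `W′` `p`-isogenous to `W`) this reduces the class-wide stub (μ♭) on the family to two numerical certificates.
Nothing about any particular curve is asserted; BSD is not proved by this.
[cite: SilvermanAEC2009, X.5 Prop. 5.4, Cor. 5.4.1] [cite: BarriosEtAl2025, Thm. 5.1, rows I₀] [cite: MurtyMurty1997, Ch. 6 §1]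
[cite: MazurTateTeitelbaum1986Invent, §I.8] [cite: Pal2012, Thm. 3.2] [cite: AbbesUllmo1996, Thm. A] [cite: Pollack2003, Prop. 6.18] -/
theorem analyticMuFlat_of_j_eq (hmod : exists_isNewformOf) (hAU : abbesUllmo_not_dvd_maninConstant_of_not_dvd_level)
    (hp : p.Prime) {q : ℤ} (hq : q = p ∨ q = -(p : ℤ))
    (hss : GoodSS W 2) (haW : W.frobeniusTrace 2 = 0) (hΔ : W.Δ < 0) (hj0 : W.j ≠ 0) (hj1728 : W.j ≠ 1728)
    (hNW : W.conductorNorm ℤ = p ^ 2) (hfW : IsNewformOf W fW)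
    (hWplus : W.rootNumber = 1 → ∃ k : ℕ, 1 ≤ k ∧ ∃ b : ℤ, Odd b ∧ ∃ m : ℤ, Odd m ∧
      ratPlusSymbol fW ((b : ℚ) / 4 ^ k) = ratPlusSymbol fW 0 + (m : ℚ) / 2)
    (hWminus : W.rootNumber = -1 → ∃ k : ℕ, 1 ≤ k ∧ ∃ b : ℤ, Odd b ∧ ∃ m : ℤ, Odd m ∧
      2 * ratMinusSymbol fW ((b : ℚ) / 4 ^ k) = m)
    {C' : VariableChange ℚ} (hW' : C' • W.quadraticTwist (q : ℚ) = W')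
    (hss' : GoodSS W' 2) (haW' : W'.frobeniusTrace 2 = 0) (hΔ' : W'.Δ < 0)
    (hNW' : W'.conductorNorm ℤ = p ^ 2) (hfW' : IsNewformOf W' fW')
    (hW'plus : W'.rootNumber = 1 → ∃ k : ℕ, 1 ≤ k ∧ ∃ b : ℤ, Odd b ∧ ∃ m : ℤ, Odd m ∧
      ratPlusSymbol fW' ((b : ℚ) / 4 ^ k) = ratPlusSymbol fW' 0 + (m : ℚ) / 2)
    (hW'minus : W'.rootNumber = -1 → ∃ k : ℕ, 1 ≤ k ∧ ∃ b : ℤ, Odd b ∧ ∃ m : ℤ, Odd m ∧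
      2 * ratMinusSymbol fW' ((b : ℚ) / 4 ^ k) = m)
    {A : WeierstrassCurve ℚ} [A.IsElliptic] [A.IsGloballyMinimal] [NeZero (A.conductorNorm ℤ)]
    {fA : CuspForm (Gamma0 (A.conductorNorm ℤ)) 2}
    (hjA : A.j = W.j) (hgoodA : A.HasGoodReductionAtPrime 2) (hfA : IsNewformOf A fA)
    (hLA : A.entireLFunction 1 ≠ 0) (Lplus Lminus : IwasawaAlgebra 2) (hPP : IsPollackPair fA 2 Lplus Lminus) :
    ∃ n : ℕ, IsUnit (PowerSeries.coeff n (kobayashiL 1 Lplus Lminus)) := by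
  obtain ⟨d, hsq, C, hA⟩ := exists_squarefree_twist_of_j_eq hjA hj0 hj1728
  have hsqN : IsSquare (W.conductorNorm ℤ) := ⟨p, by rw [hNW, sq]⟩
  have hsqN' : IsSquare (W'.conductorNorm ℤ) := ⟨p, by rw [hNW', sq]⟩
  by_cases hpd : (p : ℤ) ∣ d
  · -- `p ∣ d`: route through the second anchor, `d = q e`
    obtain ⟨k, hk⟩ := hpd
    obtain ⟨e, hde⟩ : ∃ e : ℤ, d = q * e := by
      rcases hq with rfl | rfl
      · exact ⟨k, hk⟩
      · exact ⟨-k, by rw [hk]; ring⟩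
    have hsqe : Squarefree e := Squarefree.squarefree_of_dvd ⟨q, by rw [hde]; ring⟩ hsq
    have hpe : ¬ (p : ℤ) ∣ e := by
      rintro ⟨m, hm⟩
      have hpp : (p : ℤ) * p ∣ d := by
        rcases hq with rfl | rfl
        · exact ⟨m, by rw [hde, hm]; ring⟩
        · exact ⟨-m, by rw [hde, hm]; ring⟩
      have hu : IsUnit (p : ℤ) := hsq (p : ℤ) hpp
      have h1 := hp.one_lt
      rcases Int.isUnit_iff.mp hu with h | h <;> omega
    have hcop : IsCoprime e (W'.conductorNorm ℤ : ℤ) := isCoprime_natCast_of_not_dvd_of_eq_sq hp hpe hNW'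
    -- `W′^{(e)} = D • W^{(d)}` on the nose
    have htw : W'.quadraticTwist (e : ℚ) =
        (⟨C'.u, (e : ℚ) * C'.r, 0, 0⟩ : VariableChange ℚ) • W.quadraticTwist (d : ℚ) := by
      rw [← hW', quadraticTwist_smul, quadraticTwist_quadraticTwist]
      congr 2
      rw [hde]; push_cast; ring
    have hA' : (C * (⟨C'.u, (e : ℚ) * C'.r, 0, 0⟩ : VariableChange ℚ)⁻¹) • W'.quadraticTwist (e : ℚ) = A := by
      rw [mul_smul, htw, inv_smul_smul, hA]
    exact analyticMuFlat_twist_at_of_isSquare W' hmod hAU hss' haW' hΔ' hfW' hsqN' hW'plus hW'minus hsqe hcop hA'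
      hgoodA hfA hLA Lplus Lminus hPP
  · have hcop : IsCoprime d (W.conductorNorm ℤ : ℤ) := isCoprime_natCast_of_not_dvd_of_eq_sq hp hpd hNW
    exact analyticMuFlat_twist_at_of_isSquare W hmod hAU hss haW hΔ hfW hsqN hWplus hWminus hsq hcop hA hgoodA hfA hLA
      Lplus Lminus hPP

/-- **THE FAMILY NODE IN THE STUB'S CURRENCY, FROM PRINT.** Granted BY NAME modularity (`hmod`, `hLrat`) and Abbes–Ullmo
(`hAU`), and an anchor pair `(W, W′)` as in `analyticMuFlat_of_j_eq` with its two certificates: the registered stub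
`stub_analyticMuFlatNonUnitCMTwo` (= FLAT, `AnalyticMuFlatCMTwoRankZero`) RESTRICTED TO THE FAMILY `j(A) = j(W)` — its binders
verbatim after `A.j = W.j →` (the CM, `a₂(A) = 0` and off-unit-zone binders are idle: the transport needs only good reduction
at `2` and analytic rank `0`). So on each of the five sporadic CM families (`j ≠ 0`: CM by `ℚ(√−p)`, `p = 11, 19, 43, 67, 163`)
FLAT at ALL conductors costs two numerical certificates modulo print; the class-wide residue of FLAT is the `j = 0` tail.
Nothing about any particular curve is asserted; BSD is not proved by this.
[cite: SilvermanAEC2009, X.5 Prop. 5.4, Cor. 5.4.1] [cite: BarriosEtAl2025, Thm. 5.1, rows I₀] [cite: AbbesUllmo1996, Thm. A]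
[cite: Pollack2003, Prop. 6.18] [cite: Kobayashi2003, Thm. 1.2] -/
theorem analyticMuFlat_family_of_pub (hmod : nonempty_modularParametrizationData) (hLrat : hasEntireLFunction_rat)
    (hAU : abbesUllmo_not_dvd_maninConstant_of_not_dvd_level)
    (hp : p.Prime) {q : ℤ} (hq : q = p ∨ q = -(p : ℤ))
    (hss : GoodSS W 2) (haW : W.frobeniusTrace 2 = 0) (hΔ : W.Δ < 0) (hj0 : W.j ≠ 0) (hj1728 : W.j ≠ 1728)
    (hNW : W.conductorNorm ℤ = p ^ 2) (hfW : IsNewformOf W fW)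
    (hWplus : W.rootNumber = 1 → ∃ k : ℕ, 1 ≤ k ∧ ∃ b : ℤ, Odd b ∧ ∃ m : ℤ, Odd m ∧
      ratPlusSymbol fW ((b : ℚ) / 4 ^ k) = ratPlusSymbol fW 0 + (m : ℚ) / 2)
    (hWminus : W.rootNumber = -1 → ∃ k : ℕ, 1 ≤ k ∧ ∃ b : ℤ, Odd b ∧ ∃ m : ℤ, Odd m ∧
      2 * ratMinusSymbol fW ((b : ℚ) / 4 ^ k) = m)
    {C' : VariableChange ℚ} (hW' : C' • W.quadraticTwist (q : ℚ) = W')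
    (hss' : GoodSS W' 2) (haW' : W'.frobeniusTrace 2 = 0) (hΔ' : W'.Δ < 0)
    (hNW' : W'.conductorNorm ℤ = p ^ 2) (hfW' : IsNewformOf W' fW')
    (hW'plus : W'.rootNumber = 1 → ∃ k : ℕ, 1 ≤ k ∧ ∃ b : ℤ, Odd b ∧ ∃ m : ℤ, Odd m ∧
      ratPlusSymbol fW' ((b : ℚ) / 4 ^ k) = ratPlusSymbol fW' 0 + (m : ℚ) / 2)
    (hW'minus : W'.rootNumber = -1 → ∃ k : ℕ, 1 ≤ k ∧ ∃ b : ℤ, Odd b ∧ ∃ m : ℤ, Odd m ∧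
      2 * ratMinusSymbol fW' ((b : ℚ) / 4 ^ k) = m) :
    ∀ (A : WeierstrassCurve ℚ) [A.IsElliptic] [A.IsGloballyMinimal], A.j = W.j → A.HasCM → A.analyticRank = 0 →
      GoodSS A 2 → A.frobeniusTrace 2 = 0 → 2 ∣ A.shaOrder * A.tamagawaProduct →
      ∀ [NeZero (A.conductorNorm ℤ)] (f : CuspForm (Gamma0 (A.conductorNorm ℤ)) 2), IsNewformOf A f →
        ∀ (Lplus Lminus : IwasawaAlgebra 2), IsPollackPair f 2 Lplus Lminus →
          ∃ n : ℕ, IsUnit (PowerSeries.coeff n (kobayashiL 1 Lplus Lminus)) := by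
  intro A _ _ hjA _ hrA hssA _ _ _ f hf Lplus Lminus hPP
  have hmod' : exists_isNewformOf := exists_isNewformOf_of_nonempty_modularParametrizationData hmod
  have hLA : A.entireLFunction 1 ≠ 0 := (A.analyticRank_eq_zero_iff_holds (hLrat A)).mp hrA
  exact analyticMuFlat_of_j_eq W W' hmod' hAU hp hq hss haW hΔ hj0 hj1728 hNW hfW hWplus hWminus hW' hss' haW' hΔ' hNW'
    hfW' hW'plus hW'minus hjA hssA.1 hf hLA Lplus Lminus hPP

end Family

end Summit.BirchSwinnertonDyer.BirchSwinnertonDyer.Theorems.FlatTwist.Family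

end
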